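import Summits.RiemannHypothesis.RiemannHypothesis.Theorems.WeilFormatCCinfImageMonomials
import Summits.RiemannHypothesis.RiemannHypothesis.Theorems.WeilFormatCCinfMonomialAlgebra
import Summits.RiemannHypothesis.RiemannHypothesis.Theorems.WeilFormatCCinfCouplingFamilies
import HarnessLib

/-!
# Format C, design C∞ (E3, analytic side): the ODD images COLLECTED by `(tag, power)` — the `hc` shape

Route context: Fourier–Galerkin / Schur-complement certificates of Weil positivity on a window ("format C", C∞ door;
cell memo `run/shared/lean/pub/rh-explicit/rh-explicit-weil-10/KERNEL-LEVER.md` §21; supporting stmt-RiemannHypothesis-0098;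
seat rh-explicit-weil-10).  `abs_re/im_image_pow_sub_monomials_le` (`WeilFormatCCinfImageMonomials`) give the images
`Re/Im W_a(1x^q, χ_m)` in FACTORED monomial form.  Distributing (`imageFactoredGen_eq_flat`) and collecting by power (`imageFlat_eq_collected`,
`WeilFormatCCinfMonomialCollect` — repeated here as `private` local copies because that module has no hub olean at
filing time) yields the shape of the `hc` hypothesis
of `coupling_majorant_gram_shifted` over the four image families `m^{−d}`, `log m·m^{−d}`, `C_m·m^{−d}`, `S_m·m^{−d}`
(`d ≤ D`):

* (`abs_re_image_pow_sub_collected_le`, in `WeilFormatCCinfImageCollectedEven`) —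
  `Re W_a(1x^q, χ_m) = (2a)^{-1/2}(−1)^m[Σ_d P₁(q,d)/m^d + log m·Σ_d P_L(q,d)/m^d − C_m·Σ_d P_C(q,d)/m^d + S_m·Σ_d P_S(q,d)/m^d]`
  `± (2a)^{-1/2}ρ_re(q,m₀)(m₀/m)^{E+1}`;
* `abs_im_image_pow_sub_collected_le` — the odd twin for `Im W_a(1x^q, χ_m)` (THIS file),

each `P(q,d)` an explicit finite (fiber) sum of the printed monomial coefficients; and the FAMILY form
(`abs_re_image_pow_sub_family_le` / `abs_im_image_pow_sub_family_le`: the four groups as one sum over `Fin 4 × Fin (D+1)`,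
`fourGroups_eq_sum_fin`) = the `himg` hypothesis of `cinf_hUq_even` / `cinf_hUq_odd` up to `abs_sub_collected_scale`.  Conditions on the collection depth:
`2J + 2 ≤ D` (resp. `2J + 1 ≤ D`), `q + 1 + K ≤ D`, `q + 2R + 2 ≤ D`.  Pure algebra over the landed files; standard
axioms; no definitions; no RH claim.
-/

set_option autoImplicit false
-- `Summit.RiemannHypothesis.RiemannHypothesis.…` is the layout-mandated namespace (summit = problem name).
set_option linter.dupNamespace false

noncomputable section

open Complex Filter Set MeasureTheory
open scoped Real Topology ComplexConjugate ArithmeticFunction.vonMangoldt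

namespace Summit.RiemannHypothesis.RiemannHypothesis.Theorems.WeilFormatC

open Literature.NumberTheory.LFunctions Literature.NumberTheory.LFunctions.Yoshida1992
  Literature.Analysis.SpecialFunctions

variable {a : ℝ}

/-! ## Distribution and collection of the image bracket (local copies) -/

/-- Local copy (the landed `imageFactoredGen_eq_flat` of `WeilFormatCCinfMonomialCollect`, p387107, has no hub olean
yet): `imageFactored_eq_flat` with a general polar exponent `e_r` (even images: `2r+2`; odd images: `2r+1`). -/
private theorem imageFactoredGen_eq_flat_loc (m A L g₀ s₀ C S : ℝ) (n J Kx R : ℕ) (pe : ℕ → ℕ) (p ω w K α β : ℕ → ℝ)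
    (c sN d d' : ℕ → ℝ) (hw : ∀ k, w k = ω k / m ^ (k + 1)) :
    A * (∑ r ∈ Finset.range J, p r / m ^ (pe r))
        + ∑ k ∈ Finset.range n, w k *
            (K k + α k * ((L / 2 + g₀ + ∑ N ∈ Finset.Icc 1 Kx, c N / m ^ N
                              + ∑ r ∈ Finset.range R, d r / m ^ (2 * r + 2)) - C)
                 + β k * ((s₀ + ∑ N ∈ Finset.Icc 1 Kx, sN N / m ^ N
                              - ∑ r ∈ Finset.range R, d' r / m ^ (2 * r + 1)) + S))
      = (∑ r ∈ Finset.range J, (A * p r) / m ^ (pe r)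
          + ∑ k ∈ Finset.range n, (ω k * K k + ω k * α k * g₀ + ω k * β k * s₀) / m ^ (k + 1)
          + ∑ k ∈ Finset.range n, ∑ N ∈ Finset.Icc 1 Kx, (ω k * α k * c N) / m ^ (k + 1 + N)
          + ∑ k ∈ Finset.range n, ∑ r ∈ Finset.range R, (ω k * α k * d r) / m ^ (k + 1 + (2 * r + 2))
          + ∑ k ∈ Finset.range n, ∑ N ∈ Finset.Icc 1 Kx, (ω k * β k * sN N) / m ^ (k + 1 + N)
          - ∑ k ∈ Finset.range n, ∑ r ∈ Finset.range R, (ω k * β k * d' r) / m ^ (k + 1 + (2 * r + 1)))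
        + L * ∑ k ∈ Finset.range n, (ω k * α k / 2) / m ^ (k + 1)
        - C * ∑ k ∈ Finset.range n, (ω k * α k) / m ^ (k + 1)
        + S * ∑ k ∈ Finset.range n, (ω k * β k) / m ^ (k + 1) := by
  rw [Finset.sum_congr rfl fun k _ ↦ imageTerm_eq_flat m (ω k) (w k) (K k) (α k) (β k) L g₀ s₀ C S k Kx R
    c sN d d' (hw k)]
  rw [Finset.mul_sum, Finset.mul_sum, Finset.mul_sum, Finset.mul_sum]
  simp only [Finset.sum_add_distrib, Finset.sum_sub_distrib]
  have hA : ∑ r ∈ Finset.range J, A * (p r / m ^ (pe r)) = ∑ r ∈ Finset.range J, (A * p r) / m ^ (pe r) :=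
    Finset.sum_congr rfl fun r _ ↦ by ring
  rw [hA]
  ring

/-- Local copy of `imageFlat_eq_collected` (`WeilFormatCCinfMonomialCollect`): **Collection of the distributed image bracket** (all powers `≤ D`). -/
private theorem imageFlat_eq_collected_loc (m A L g₀ s₀ C S : ℝ) {n J Kx R D : ℕ} (pe : ℕ → ℕ) (p ω K α β : ℕ → ℝ)
    (c sN d d' : ℕ → ℝ) (hpe : ∀ r ∈ Finset.range J, pe r ≤ D) (hn : ∀ k ∈ Finset.range n, k + 1 ≤ D)
    (hN : ∀ x ∈ Finset.range n ×ˢ Finset.Icc 1 Kx, x.1 + 1 + x.2 ≤ D)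
    (hR : ∀ x ∈ Finset.range n ×ˢ Finset.range R, x.1 + 1 + (2 * x.2 + 2) ≤ D)
    (hR' : ∀ x ∈ Finset.range n ×ˢ Finset.range R, x.1 + 1 + (2 * x.2 + 1) ≤ D) :
    (∑ r ∈ Finset.range J, (A * p r) / m ^ (pe r)
          + ∑ k ∈ Finset.range n, (ω k * K k + ω k * α k * g₀ + ω k * β k * s₀) / m ^ (k + 1)
          + ∑ k ∈ Finset.range n, ∑ N ∈ Finset.Icc 1 Kx, (ω k * α k * c N) / m ^ (k + 1 + N)
          + ∑ k ∈ Finset.range n, ∑ r ∈ Finset.range R, (ω k * α k * d r) / m ^ (k + 1 + (2 * r + 2))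
          + ∑ k ∈ Finset.range n, ∑ N ∈ Finset.Icc 1 Kx, (ω k * β k * sN N) / m ^ (k + 1 + N)
          - ∑ k ∈ Finset.range n, ∑ r ∈ Finset.range R, (ω k * β k * d' r) / m ^ (k + 1 + (2 * r + 1)))
        + L * ∑ k ∈ Finset.range n, (ω k * α k / 2) / m ^ (k + 1)
        - C * ∑ k ∈ Finset.range n, (ω k * α k) / m ^ (k + 1)
        + S * ∑ k ∈ Finset.range n, (ω k * β k) / m ^ (k + 1)
      = ∑ dd ∈ Finset.range (D + 1),
          ((∑ r ∈ (Finset.range J).filter (fun r ↦ pe r = dd), A * p r)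
            + (∑ k ∈ (Finset.range n).filter (fun k ↦ k + 1 = dd), (ω k * K k + ω k * α k * g₀ + ω k * β k * s₀))
            + (∑ x ∈ (Finset.range n ×ˢ Finset.Icc 1 Kx).filter (fun x ↦ x.1 + 1 + x.2 = dd), ω x.1 * α x.1 * c x.2)
            + (∑ x ∈ (Finset.range n ×ˢ Finset.range R).filter (fun x ↦ x.1 + 1 + (2 * x.2 + 2) = dd),
                ω x.1 * α x.1 * d x.2)
            + (∑ x ∈ (Finset.range n ×ˢ Finset.Icc 1 Kx).filter (fun x ↦ x.1 + 1 + x.2 = dd), ω x.1 * β x.1 * sN x.2)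
            - (∑ x ∈ (Finset.range n ×ˢ Finset.range R).filter (fun x ↦ x.1 + 1 + (2 * x.2 + 1) = dd),
                ω x.1 * β x.1 * d' x.2)) / m ^ dd
        + L * ∑ dd ∈ Finset.range (D + 1), (∑ k ∈ (Finset.range n).filter (fun k ↦ k + 1 = dd), ω k * α k / 2) / m ^ dd
        - C * ∑ dd ∈ Finset.range (D + 1), (∑ k ∈ (Finset.range n).filter (fun k ↦ k + 1 = dd), ω k * α k) / m ^ dd
        + S * ∑ dd ∈ Finset.range (D + 1), (∑ k ∈ (Finset.range n).filter (fun k ↦ k + 1 = dd), ω k * β k) / m ^ dd := by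
  rw [sum_div_pow_eq_sum_fiber _ (fun r ↦ A * p r) pe hpe,
    sum_div_pow_eq_sum_fiber _ (fun k ↦ ω k * K k + ω k * α k * g₀ + ω k * β k * s₀) (fun k ↦ k + 1) hn,
    sum_div_pow_eq_sum_fiber _ (fun k ↦ ω k * α k / 2) (fun k ↦ k + 1) hn,
    sum_div_pow_eq_sum_fiber _ (fun k ↦ ω k * α k) (fun k ↦ k + 1) hn,
    sum_div_pow_eq_sum_fiber _ (fun k ↦ ω k * β k) (fun k ↦ k + 1) hn,
    sum_sum_div_pow_eq_sum_product _ _ (fun k N ↦ ω k * α k * c N) (fun k N ↦ k + 1 + N),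
    sum_div_pow_eq_sum_fiber _ (fun x : ℕ × ℕ ↦ ω x.1 * α x.1 * c x.2) (fun x ↦ x.1 + 1 + x.2) hN,
    sum_sum_div_pow_eq_sum_product _ _ (fun k r ↦ ω k * α k * d r) (fun k r ↦ k + 1 + (2 * r + 2)),
    sum_div_pow_eq_sum_fiber _ (fun x : ℕ × ℕ ↦ ω x.1 * α x.1 * d x.2) (fun x ↦ x.1 + 1 + (2 * x.2 + 2)) hR,
    sum_sum_div_pow_eq_sum_product _ _ (fun k N ↦ ω k * β k * sN N) (fun k N ↦ k + 1 + N),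
    sum_div_pow_eq_sum_fiber _ (fun x : ℕ × ℕ ↦ ω x.1 * β x.1 * sN x.2) (fun x ↦ x.1 + 1 + x.2) hN,
    sum_sum_div_pow_eq_sum_product _ _ (fun k r ↦ ω k * β k * d' r) (fun k r ↦ k + 1 + (2 * r + 1)),
    sum_div_pow_eq_sum_fiber _ (fun x : ℕ × ℕ ↦ ω x.1 * β x.1 * d' x.2) (fun x ↦ x.1 + 1 + (2 * x.2 + 1)) hR']
  simp only [add_div, sub_div, Finset.sum_add_distrib, Finset.sum_sub_distrib]

/-! ## The odd images collected -/

/-- **`Im W_a(1x^q, χ_m)` collected by `(tag, power)`** (hypotheses of `abs_im_image_pow_sub_monomials_le` plus a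
collection depth `D` with `2J + 1 ≤ D`, `q + 1 + K ≤ D`, `q + 2R + 2 ≤ D`).  The polar constant enters as
`A = −8S_q(e^{a/2} − e^{−a/2})` and the `F`-weights as `β_k = −(a^{q−k} + (−a)^{q−k})Re(i^{k+1})`. -/
theorem abs_im_image_pow_sub_collected_le (ha : 0 < a) {m₀ m : ℕ} (hm₀ : 2 ≤ π * m₀ / a) (hmm : m₀ ≤ m)
    (q : ℕ) {ν : ℕ} (hν : ν ≠ 0) {K : ℕ} (hK : 2 * ν ≤ K) {R J : ℕ} {E : ℕ} (hE1 : E + 1 ≤ 2 * ν)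
    (hE2 : E ≤ K) (hE3 : E ≤ 2 * R) (hEJ : E ≤ 2 * J) {D : ℕ}
    (hDJ : 2 * J + 1 ≤ D) (hDK : q + 1 + K ≤ D) (hDR : q + 2 * R + 2 ≤ D) :
    |(weilWindowSesq a ((Icc (-a) a).indicator fun x : ℝ ↦ ((x : ℂ)) ^ q) (chi a m)).im
        - (1 / Real.sqrt (2 * a)) * (-1 : ℝ) ^ m *
          (∑ dd ∈ Finset.range (D + 1),
              ((∑ r ∈ (Finset.range J).filter (fun r ↦ 2 * r + 1 = dd), (-(8 * (∫ x in (-a)..a, x ^ q * Real.sinh (x / 2)) * (Real.exp (a / 2) - Real.exp (-(a / 2))))) * (fun r : ℕ ↦ (-1 : ℝ) ^ r * (a / (4 * π)) * (a ^ 2 / (4 * π ^ 2)) ^ r) r)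
                + (∑ k ∈ (Finset.range (q + 1)).filter (fun k ↦ k + 1 = dd),
                    ((fun k : ℕ ↦ (-1 : ℝ) ^ k * (q.descFactorial k : ℝ) * (a / π) ^ (k + 1)) k * (fun k : ℕ ↦ (I ^ (k + 1) *
                      ((∑ n ∈ weilPrimeIndex a, ((Λ n : ℝ) / Real.sqrt n : ℂ) *
                          (((a : ℂ)) ^ (q - k) - (((-a : ℝ)) : ℂ) ^ (q - k)
                            + (((a : ℂ)) ^ (q - k) - (((a - Real.log n : ℝ)) : ℂ) ^ (q - k))
                            + ((((-a + Real.log n : ℝ)) : ℂ) ^ (q - k) - (((-a : ℝ)) : ℂ) ^ (q - k))))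
                        + ((∫ t in Ioc 0 (2 * a), weilArchDensity t *
                            ((a ^ (q - k) - (a - t) ^ (q - k)) + ((-a + t) ^ (q - k) - (-a) ^ (q - k))) : ℝ) : ℂ)
                        + (2 * ((∫ t in Ioi (2 * a), weilArchDensity t : ℝ) : ℂ) - (weilMarkovConstant a : ℂ))
                            * (((a : ℂ)) ^ (q - k) - (((-a : ℝ)) : ℂ) ^ (q - k)))).im) k
                      + (fun k : ℕ ↦ (-1 : ℝ) ^ k * (q.descFactorial k : ℝ) * (a / π) ^ (k + 1)) k * (fun k : ℕ ↦ (a ^ (q - k) - (-a) ^ (q - k)) * (I ^ (k + 1)).im) k * (Real.log (π / (2 * a)) / 2 - reDigammaQuarter 0 / 2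
                            - ∑' l : ℕ, Real.exp (-(2 * a * digammaNode l)) / digammaNode l)
                      + (fun k : ℕ ↦ (-1 : ℝ) ^ k * (q.descFactorial k : ℝ) * (a / π) ^ (k + 1)) k * (fun k : ℕ ↦ -((a ^ (q - k) + (-a) ^ (q - k)) * (I ^ (k + 1)).re)) k * (π / 4)))
                + (∑ x ∈ (Finset.range (q + 1) ×ˢ Finset.Icc 1 K).filter (fun x ↦ x.1 + 1 + x.2 = dd),
                    (fun k : ℕ ↦ (-1 : ℝ) ^ k * (q.descFactorial k : ℝ) * (a / π) ^ (k + 1)) x.1 * (fun k : ℕ ↦ (a ^ (q - k) - (-a) ^ (q - k)) * (I ^ (k + 1)).im) x.1 * (fun N : ℕ ↦ (if N % 4 = 0 then (1 : ℝ) else if N % 4 = 2 then -1 else 0)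
                            * (1 - 1 / (2 * (N : ℝ))
                                - (∑ l ∈ Finset.Icc 1 ν, (bernoulli (2 * l) : ℝ) / (2 * l) * 16 ^ l
                                    * (((N - 1).choose (2 * l - 1) : ℕ) : ℝ)) / 2)
                            * (a / (2 * π)) ^ N) x.2)
                + (∑ x ∈ (Finset.range (q + 1) ×ˢ Finset.range R).filter (fun x ↦ x.1 + 1 + (2 * x.2 + 2) = dd),
                    (fun k : ℕ ↦ (-1 : ℝ) ^ k * (q.descFactorial k : ℝ) * (a / π) ^ (k + 1)) x.1 * (fun k : ℕ ↦ (a ^ (q - k) - (-a) ^ (q - k)) * (I ^ (k + 1)).im) x.1 * (fun r : ℕ ↦ (-1 : ℝ) ^ r *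
                            (∑' l : ℕ, Real.exp (-(2 * a * digammaNode l)) * digammaNode l ^ (2 * r + 1))
                            * (a / π) ^ (2 * r + 2)) x.2)
                + (∑ x ∈ (Finset.range (q + 1) ×ˢ Finset.Icc 1 K).filter (fun x ↦ x.1 + 1 + x.2 = dd),
                    (fun k : ℕ ↦ (-1 : ℝ) ^ k * (q.descFactorial k : ℝ) * (a / π) ^ (k + 1)) x.1 * (fun k : ℕ ↦ -((a ^ (q - k) + (-a) ^ (q - k)) * (I ^ (k + 1)).re)) x.1 * (fun N : ℕ ↦ (if N % 4 = 1 then (1 : ℝ) else if N % 4 = 3 then -1 else 0)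
                            * (1 - 1 / (2 * (N : ℝ))
                                - (∑ l ∈ Finset.Icc 1 ν, (bernoulli (2 * l) : ℝ) / (2 * l) * 16 ^ l
                                    * (((N - 1).choose (2 * l - 1) : ℕ) : ℝ)) / 2)
                            * (a / (2 * π)) ^ N) x.2)
                - (∑ x ∈ (Finset.range (q + 1) ×ˢ Finset.range R).filter (fun x ↦ x.1 + 1 + (2 * x.2 + 1) = dd),
                    (fun k : ℕ ↦ (-1 : ℝ) ^ k * (q.descFactorial k : ℝ) * (a / π) ^ (k + 1)) x.1 * (fun k : ℕ ↦ -((a ^ (q - k) + (-a) ^ (q - k)) * (I ^ (k + 1)).re)) x.1 * (fun r : ℕ ↦ (-1 : ℝ) ^ r *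
                            (∑' l : ℕ, Real.exp (-(2 * a * digammaNode l)) * digammaNode l ^ (2 * r))
                            * (a / π) ^ (2 * r + 1)) x.2)) / (m : ℝ) ^ dd
            + Real.log m * ∑ dd ∈ Finset.range (D + 1),
                (∑ k ∈ (Finset.range (q + 1)).filter (fun k ↦ k + 1 = dd), (fun k : ℕ ↦ (-1 : ℝ) ^ k * (q.descFactorial k : ℝ) * (a / π) ^ (k + 1)) k * (fun k : ℕ ↦ (a ^ (q - k) - (-a) ^ (q - k)) * (I ^ (k + 1)).im) k / 2) / (m : ℝ) ^ dd
            - (∑ n ∈ weilPrimeIndex a, (Λ n : ℝ) / Real.sqrt n * Real.cos (π * m / a * Real.log n)) * ∑ dd ∈ Finset.range (D + 1),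
                (∑ k ∈ (Finset.range (q + 1)).filter (fun k ↦ k + 1 = dd), (fun k : ℕ ↦ (-1 : ℝ) ^ k * (q.descFactorial k : ℝ) * (a / π) ^ (k + 1)) k * (fun k : ℕ ↦ (a ^ (q - k) - (-a) ^ (q - k)) * (I ^ (k + 1)).im) k) / (m : ℝ) ^ dd
            + (∑ n ∈ weilPrimeIndex a, (Λ n : ℝ) / Real.sqrt n * Real.sin (π * m / a * Real.log n)) * ∑ dd ∈ Finset.range (D + 1),
                (∑ k ∈ (Finset.range (q + 1)).filter (fun k ↦ k + 1 = dd), (fun k : ℕ ↦ (-1 : ℝ) ^ k * (q.descFactorial k : ℝ) * (a / π) ^ (k + 1)) k * (fun k : ℕ ↦ -((a ^ (q - k) + (-a) ^ (q - k)) * (I ^ (k + 1)).re)) k) / (m : ℝ) ^ dd)|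
      ≤ (1 / Real.sqrt (2 * a)) *
          ( |(8 * (∫ x in (-a)..a, x ^ q * Real.sinh (x / 2)) * (Real.exp (a / 2) - Real.exp (-(a / 2))))|
              * (a / (4 * π) * (a ^ 2 / (4 * π ^ 2)) ^ J / (m₀ : ℝ) ^ (2 * J + 1))
            + ∑ k ∈ Finset.range (q + 1), (q.descFactorial k : ℝ) * (a / (π * m₀)) ^ (k + 1) *
                ( |(a ^ (q - k) - (-a) ^ (q - k)) * (I ^ (k + 1)).im| *
                    ((4 * Real.pi ^ 2 / 3 * ((2 * ν + 1).factorial : ℝ) / (2 * Real.pi) ^ (2 * ν + 1)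
                      * (4 * (1 / (4 * (π * m₀ / a / 2)))) ^ (2 * ν)
                    + (1 / (4 * (π * m₀ / a / 2))) ^ (K + 1) / ((K + 1) * (1 - 1 / (4 * (π * m₀ / a / 2))))
                    + 2 * (1 / (4 * (π * m₀ / a / 2))) ^ (K + 1)
                    + ∑ k ∈ Finset.Icc 1 ν, |(bernoulli (2 * k) : ℝ) / (2 * k)| * 2 ^ (K + 1 + 4 * k)
                        * (1 / (4 * (π * m₀ / a / 2))) ^ (K + 1)) / 2
                  + (∑' k : ℕ, Real.exp (-(2 * a * digammaNode k)) * digammaNode k ^ (2 * R + 1))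
                      / |π * m₀ / a| ^ (2 * R + 2))
                  + |(a ^ (q - k) + (-a) ^ (q - k)) * (I ^ (k + 1)).re| *
                    ((4 * Real.pi ^ 2 / 3 * ((2 * ν + 1).factorial : ℝ) / (2 * Real.pi) ^ (2 * ν + 1)
                      * (4 * (1 / (4 * (π * m₀ / a / 2)))) ^ (2 * ν)
                    + (1 / (4 * (π * m₀ / a / 2))) ^ (K + 1) / ((K + 1) * (1 - 1 / (4 * (π * m₀ / a / 2))))
                    + 2 * (1 / (4 * (π * m₀ / a / 2))) ^ (K + 1)
                    + ∑ k ∈ Finset.Icc 1 ν, |(bernoulli (2 * k) : ℝ) / (2 * k)| * 2 ^ (K + 1 + 4 * k)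
                        * (1 / (4 * (π * m₀ / a / 2))) ^ (K + 1)) / 2
                  + (∑' k : ℕ, Real.exp (-(2 * a * digammaNode k)) * digammaNode k ^ (2 * R))
                      / |π * m₀ / a| ^ (2 * R + 1)) ) )
        * ((m₀ : ℝ) / m) ^ (E + 1) := by
  have h := abs_im_image_pow_sub_monomials_le ha hm₀ hmm q hν hK R J hE1 hE2 hE3 hEJ
  -- the printed approximant in template shape
  have eshape : ∀ (Pa : ℝ) (G F : ℕ → ℝ),
      (1 / Real.sqrt (2 * a)) * (-1 : ℝ) ^ m *
          ( -((8 * (∫ x in (-a)..a, x ^ q * Real.sinh (x / 2)) * (Real.exp (a / 2) - Real.exp (-(a / 2)))) * Pa)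
            + ∑ k ∈ Finset.range (q + 1), ((-1 : ℝ) ^ k * (q.descFactorial k : ℝ) * (a / (π * m)) ^ (k + 1)) *
                ( (I ^ (k + 1) *
                      ((∑ n ∈ weilPrimeIndex a, ((Λ n : ℝ) / Real.sqrt n : ℂ) *
                          (((a : ℂ)) ^ (q - k) - (((-a : ℝ)) : ℂ) ^ (q - k)
                            + (((a : ℂ)) ^ (q - k) - (((a - Real.log n : ℝ)) : ℂ) ^ (q - k))
                            + ((((-a + Real.log n : ℝ)) : ℂ) ^ (q - k) - (((-a : ℝ)) : ℂ) ^ (q - k))))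
                        + ((∫ t in Ioc 0 (2 * a), weilArchDensity t *
                            ((a ^ (q - k) - (a - t) ^ (q - k)) + ((-a + t) ^ (q - k) - (-a) ^ (q - k))) : ℝ) : ℂ)
                        + (2 * ((∫ t in Ioi (2 * a), weilArchDensity t : ℝ) : ℂ) - (weilMarkovConstant a : ℂ))
                            * (((a : ℂ)) ^ (q - k) - (((-a : ℝ)) : ℂ) ^ (q - k)))).im
                  + (a ^ (q - k) - (-a) ^ (q - k)) * (I ^ (k + 1)).im * G k
                  - (a ^ (q - k) + (-a) ^ (q - k)) * (I ^ (k + 1)).re * F k ) )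
        = (1 / Real.sqrt (2 * a)) * (-1 : ℝ) ^ m *
          ( (-(8 * (∫ x in (-a)..a, x ^ q * Real.sinh (x / 2)) * (Real.exp (a / 2) - Real.exp (-(a / 2))))) * Pa
            + ∑ k ∈ Finset.range (q + 1), ((-1 : ℝ) ^ k * (q.descFactorial k : ℝ) * (a / (π * m)) ^ (k + 1)) *
                ( (I ^ (k + 1) *
                      ((∑ n ∈ weilPrimeIndex a, ((Λ n : ℝ) / Real.sqrt n : ℂ) *
                          (((a : ℂ)) ^ (q - k) - (((-a : ℝ)) : ℂ) ^ (q - k)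
                            + (((a : ℂ)) ^ (q - k) - (((a - Real.log n : ℝ)) : ℂ) ^ (q - k))
                            + ((((-a + Real.log n : ℝ)) : ℂ) ^ (q - k) - (((-a : ℝ)) : ℂ) ^ (q - k))))
                        + ((∫ t in Ioc 0 (2 * a), weilArchDensity t *
                            ((a ^ (q - k) - (a - t) ^ (q - k)) + ((-a + t) ^ (q - k) - (-a) ^ (q - k))) : ℝ) : ℂ)
                        + (2 * ((∫ t in Ioi (2 * a), weilArchDensity t : ℝ) : ℂ) - (weilMarkovConstant a : ℂ))
                            * (((a : ℂ)) ^ (q - k) - (((-a : ℝ)) : ℂ) ^ (q - k)))).im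
                  + (a ^ (q - k) - (-a) ^ (q - k)) * (I ^ (k + 1)).im * G k
                  + -((a ^ (q - k) + (-a) ^ (q - k)) * (I ^ (k + 1)).re) * F k ) ) := by
    intro Pa G F
    congr 1
    rw [neg_mul]
    congr 1
    exact Finset.sum_congr rfl fun k _ ↦ by ring
  rw [eshape] at h
  have eflat := imageFactoredGen_eq_flat_loc (m : ℝ) (-(8 * (∫ x in (-a)..a, x ^ q * Real.sinh (x / 2)) * (Real.exp (a / 2) - Real.exp (-(a / 2))))) (Real.log m) (Real.log (π / (2 * a)) / 2 - reDigammaQuarter 0 / 2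
                            - ∑' l : ℕ, Real.exp (-(2 * a * digammaNode l)) / digammaNode l) (π / 4) (∑ n ∈ weilPrimeIndex a, (Λ n : ℝ) / Real.sqrt n * Real.cos (π * m / a * Real.log n)) (∑ n ∈ weilPrimeIndex a, (Λ n : ℝ) / Real.sqrt n * Real.sin (π * m / a * Real.log n)) (q + 1) J K R
    (fun r ↦ 2 * r + 1) (fun r : ℕ ↦ (-1 : ℝ) ^ r * (a / (4 * π)) * (a ^ 2 / (4 * π ^ 2)) ^ r) (fun k : ℕ ↦ (-1 : ℝ) ^ k * (q.descFactorial k : ℝ) * (a / π) ^ (k + 1))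
    (fun k ↦ ((-1 : ℝ) ^ k * (q.descFactorial k : ℝ) * (a / (π * m)) ^ (k + 1)))
    (fun k : ℕ ↦ (I ^ (k + 1) *
                      ((∑ n ∈ weilPrimeIndex a, ((Λ n : ℝ) / Real.sqrt n : ℂ) *
                          (((a : ℂ)) ^ (q - k) - (((-a : ℝ)) : ℂ) ^ (q - k)
                            + (((a : ℂ)) ^ (q - k) - (((a - Real.log n : ℝ)) : ℂ) ^ (q - k))
                            + ((((-a + Real.log n : ℝ)) : ℂ) ^ (q - k) - (((-a : ℝ)) : ℂ) ^ (q - k))))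
                        + ((∫ t in Ioc 0 (2 * a), weilArchDensity t *
                            ((a ^ (q - k) - (a - t) ^ (q - k)) + ((-a + t) ^ (q - k) - (-a) ^ (q - k))) : ℝ) : ℂ)
                        + (2 * ((∫ t in Ioi (2 * a), weilArchDensity t : ℝ) : ℂ) - (weilMarkovConstant a : ℂ))
                            * (((a : ℂ)) ^ (q - k) - (((-a : ℝ)) : ℂ) ^ (q - k)))).im)
    (fun k : ℕ ↦ (a ^ (q - k) - (-a) ^ (q - k)) * (I ^ (k + 1)).im) (fun k : ℕ ↦ -((a ^ (q - k) + (-a) ^ (q - k)) * (I ^ (k + 1)).re)) (fun N : ℕ ↦ (if N % 4 = 0 then (1 : ℝ) else if N % 4 = 2 then -1 else 0)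
                            * (1 - 1 / (2 * (N : ℝ))
                                - (∑ l ∈ Finset.Icc 1 ν, (bernoulli (2 * l) : ℝ) / (2 * l) * 16 ^ l
                                    * (((N - 1).choose (2 * l - 1) : ℕ) : ℝ)) / 2)
                            * (a / (2 * π)) ^ N) (fun N : ℕ ↦ (if N % 4 = 1 then (1 : ℝ) else if N % 4 = 3 then -1 else 0)
                            * (1 - 1 / (2 * (N : ℝ))
                                - (∑ l ∈ Finset.Icc 1 ν, (bernoulli (2 * l) : ℝ) / (2 * l) * 16 ^ l
                                    * (((N - 1).choose (2 * l - 1) : ℕ) : ℝ)) / 2)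
                            * (a / (2 * π)) ^ N) (fun r : ℕ ↦ (-1 : ℝ) ^ r *
                            (∑' l : ℕ, Real.exp (-(2 * a * digammaNode l)) * digammaNode l ^ (2 * r + 1))
                            * (a / π) ^ (2 * r + 2)) (fun r : ℕ ↦ (-1 : ℝ) ^ r *
                            (∑' l : ℕ, Real.exp (-(2 * a * digammaNode l)) * digammaNode l ^ (2 * r))
                            * (a / π) ^ (2 * r + 1))
    (fun k ↦ by rw [← div_div, div_pow]; ring)
  beta_reduce at eflat
  have ecoll := imageFlat_eq_collected_loc (m : ℝ) (-(8 * (∫ x in (-a)..a, x ^ q * Real.sinh (x / 2)) * (Real.exp (a / 2) - Real.exp (-(a / 2))))) (Real.log m) (Real.log (π / (2 * a)) / 2 - reDigammaQuarter 0 / 2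
                            - ∑' l : ℕ, Real.exp (-(2 * a * digammaNode l)) / digammaNode l) (π / 4) (∑ n ∈ weilPrimeIndex a, (Λ n : ℝ) / Real.sqrt n * Real.cos (π * m / a * Real.log n)) (∑ n ∈ weilPrimeIndex a, (Λ n : ℝ) / Real.sqrt n * Real.sin (π * m / a * Real.log n))
    (n := q + 1) (J := J) (Kx := K) (R := R) (D := D)
    (fun r ↦ 2 * r + 1) (fun r : ℕ ↦ (-1 : ℝ) ^ r * (a / (4 * π)) * (a ^ 2 / (4 * π ^ 2)) ^ r) (fun k : ℕ ↦ (-1 : ℝ) ^ k * (q.descFactorial k : ℝ) * (a / π) ^ (k + 1))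
    (fun k : ℕ ↦ (I ^ (k + 1) *
                      ((∑ n ∈ weilPrimeIndex a, ((Λ n : ℝ) / Real.sqrt n : ℂ) *
                          (((a : ℂ)) ^ (q - k) - (((-a : ℝ)) : ℂ) ^ (q - k)
                            + (((a : ℂ)) ^ (q - k) - (((a - Real.log n : ℝ)) : ℂ) ^ (q - k))
                            + ((((-a + Real.log n : ℝ)) : ℂ) ^ (q - k) - (((-a : ℝ)) : ℂ) ^ (q - k))))
                        + ((∫ t in Ioc 0 (2 * a), weilArchDensity t *
                            ((a ^ (q - k) - (a - t) ^ (q - k)) + ((-a + t) ^ (q - k) - (-a) ^ (q - k))) : ℝ) : ℂ)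
                        + (2 * ((∫ t in Ioi (2 * a), weilArchDensity t : ℝ) : ℂ) - (weilMarkovConstant a : ℂ))
                            * (((a : ℂ)) ^ (q - k) - (((-a : ℝ)) : ℂ) ^ (q - k)))).im)
    (fun k : ℕ ↦ (a ^ (q - k) - (-a) ^ (q - k)) * (I ^ (k + 1)).im) (fun k : ℕ ↦ -((a ^ (q - k) + (-a) ^ (q - k)) * (I ^ (k + 1)).re)) (fun N : ℕ ↦ (if N % 4 = 0 then (1 : ℝ) else if N % 4 = 2 then -1 else 0)
                            * (1 - 1 / (2 * (N : ℝ))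
                                - (∑ l ∈ Finset.Icc 1 ν, (bernoulli (2 * l) : ℝ) / (2 * l) * 16 ^ l
                                    * (((N - 1).choose (2 * l - 1) : ℕ) : ℝ)) / 2)
                            * (a / (2 * π)) ^ N) (fun N : ℕ ↦ (if N % 4 = 1 then (1 : ℝ) else if N % 4 = 3 then -1 else 0)
                            * (1 - 1 / (2 * (N : ℝ))
                                - (∑ l ∈ Finset.Icc 1 ν, (bernoulli (2 * l) : ℝ) / (2 * l) * 16 ^ l
                                    * (((N - 1).choose (2 * l - 1) : ℕ) : ℝ)) / 2)
                            * (a / (2 * π)) ^ N) (fun r : ℕ ↦ (-1 : ℝ) ^ r *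
                            (∑' l : ℕ, Real.exp (-(2 * a * digammaNode l)) * digammaNode l ^ (2 * r + 1))
                            * (a / π) ^ (2 * r + 2)) (fun r : ℕ ↦ (-1 : ℝ) ^ r *
                            (∑' l : ℕ, Real.exp (-(2 * a * digammaNode l)) * digammaNode l ^ (2 * r))
                            * (a / π) ^ (2 * r + 1))
    (fun r hr ↦ by have := Finset.mem_range.1 hr; omega)
    (fun k hk ↦ by have := Finset.mem_range.1 hk; omega)
    (fun x hx ↦ by
      have h1 := Finset.mem_range.1 (Finset.mem_product.1 hx).1
      have h2 := (Finset.mem_Icc.1 (Finset.mem_product.1 hx).2).2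
      omega)
    (fun x hx ↦ by
      have h1 := Finset.mem_range.1 (Finset.mem_product.1 hx).1
      have h2 := Finset.mem_range.1 (Finset.mem_product.1 hx).2
      omega)
    (fun x hx ↦ by
      have h1 := Finset.mem_range.1 (Finset.mem_product.1 hx).1
      have h2 := Finset.mem_range.1 (Finset.mem_product.1 hx).2
      omega)
  beta_reduce at ecoll
  rw [eflat, ecoll] at h
  exact h

/-! ## The odd images as ONE family sum (the `himg` shape of `cinf_hUq_odd`) -/

/-- **Family form** of `abs_im_image_pow_sub_collected_le`: the four collected groups as ONE family sum over `Fin 4 × Fin (D+1)`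
(`fourGroups_eq_sum_fin`; tags `1, log m, −C_m, S_m`).  One `abs_sub_collected_scale` (moving `(2a)^{-1/2}` into the
coefficients) turns it into the `himg` shape of `cinf_hUq_even/odd`. -/
theorem abs_im_image_pow_sub_family_le (ha : 0 < a) {m₀ m : ℕ} (hm₀ : 2 ≤ π * m₀ / a) (hmm : m₀ ≤ m)
    (q : ℕ) {ν : ℕ} (hν : ν ≠ 0) {K : ℕ} (hK : 2 * ν ≤ K) {R J : ℕ} {E : ℕ} (hE1 : E + 1 ≤ 2 * ν)
    (hE2 : E ≤ K) (hE3 : E ≤ 2 * R) (hEJ : E ≤ 2 * J) {D : ℕ}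
    (hDJ : 2 * J + 1 ≤ D) (hDK : q + 1 + K ≤ D) (hDR : q + 2 * R + 2 ≤ D) :
    |(weilWindowSesq a ((Icc (-a) a).indicator fun x : ℝ ↦ ((x : ℂ)) ^ q) (chi a m)).im
        - (1 / Real.sqrt (2 * a)) * (-1 : ℝ) ^ m *
          ∑ x : Fin 4 × Fin (D + 1),
            ((![fun dd : ℕ ↦ (∑ r ∈ (Finset.range J).filter (fun r ↦ 2 * r + 1 = dd), (-(8 * (∫ x in (-a)..a, x ^ q * Real.sinh (x / 2)) * (Real.exp (a / 2) - Real.exp (-(a / 2))))) * (fun r : ℕ ↦ (-1 : ℝ) ^ r * (a / (4 * π)) * (a ^ 2 / (4 * π ^ 2)) ^ r) r)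
                + (∑ k ∈ (Finset.range (q + 1)).filter (fun k ↦ k + 1 = dd),
                    ((fun k : ℕ ↦ (-1 : ℝ) ^ k * (q.descFactorial k : ℝ) * (a / π) ^ (k + 1)) k * (fun k : ℕ ↦ (I ^ (k + 1) *
                      ((∑ n ∈ weilPrimeIndex a, ((Λ n : ℝ) / Real.sqrt n : ℂ) *
                          (((a : ℂ)) ^ (q - k) - (((-a : ℝ)) : ℂ) ^ (q - k)
                            + (((a : ℂ)) ^ (q - k) - (((a - Real.log n : ℝ)) : ℂ) ^ (q - k))
                            + ((((-a + Real.log n : ℝ)) : ℂ) ^ (q - k) - (((-a : ℝ)) : ℂ) ^ (q - k))))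
                        + ((∫ t in Ioc 0 (2 * a), weilArchDensity t *
                            ((a ^ (q - k) - (a - t) ^ (q - k)) + ((-a + t) ^ (q - k) - (-a) ^ (q - k))) : ℝ) : ℂ)
                        + (2 * ((∫ t in Ioi (2 * a), weilArchDensity t : ℝ) : ℂ) - (weilMarkovConstant a : ℂ))
                            * (((a : ℂ)) ^ (q - k) - (((-a : ℝ)) : ℂ) ^ (q - k)))).im) k
                      + (fun k : ℕ ↦ (-1 : ℝ) ^ k * (q.descFactorial k : ℝ) * (a / π) ^ (k + 1)) k * (fun k : ℕ ↦ (a ^ (q - k) - (-a) ^ (q - k)) * (I ^ (k + 1)).im) k * (Real.log (π / (2 * a)) / 2 - reDigammaQuarter 0 / 2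
                            - ∑' l : ℕ, Real.exp (-(2 * a * digammaNode l)) / digammaNode l)
                      + (fun k : ℕ ↦ (-1 : ℝ) ^ k * (q.descFactorial k : ℝ) * (a / π) ^ (k + 1)) k * (fun k : ℕ ↦ -((a ^ (q - k) + (-a) ^ (q - k)) * (I ^ (k + 1)).re)) k * (π / 4)))
                + (∑ x ∈ (Finset.range (q + 1) ×ˢ Finset.Icc 1 K).filter (fun x ↦ x.1 + 1 + x.2 = dd),
                    (fun k : ℕ ↦ (-1 : ℝ) ^ k * (q.descFactorial k : ℝ) * (a / π) ^ (k + 1)) x.1 * (fun k : ℕ ↦ (a ^ (q - k) - (-a) ^ (q - k)) * (I ^ (k + 1)).im) x.1 * (fun N : ℕ ↦ (if N % 4 = 0 then (1 : ℝ) else if N % 4 = 2 then -1 else 0)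
                            * (1 - 1 / (2 * (N : ℝ))
                                - (∑ l ∈ Finset.Icc 1 ν, (bernoulli (2 * l) : ℝ) / (2 * l) * 16 ^ l
                                    * (((N - 1).choose (2 * l - 1) : ℕ) : ℝ)) / 2)
                            * (a / (2 * π)) ^ N) x.2)
                + (∑ x ∈ (Finset.range (q + 1) ×ˢ Finset.range R).filter (fun x ↦ x.1 + 1 + (2 * x.2 + 2) = dd),
                    (fun k : ℕ ↦ (-1 : ℝ) ^ k * (q.descFactorial k : ℝ) * (a / π) ^ (k + 1)) x.1 * (fun k : ℕ ↦ (a ^ (q - k) - (-a) ^ (q - k)) * (I ^ (k + 1)).im) x.1 * (fun r : ℕ ↦ (-1 : ℝ) ^ r *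
                            (∑' l : ℕ, Real.exp (-(2 * a * digammaNode l)) * digammaNode l ^ (2 * r + 1))
                            * (a / π) ^ (2 * r + 2)) x.2)
                + (∑ x ∈ (Finset.range (q + 1) ×ˢ Finset.Icc 1 K).filter (fun x ↦ x.1 + 1 + x.2 = dd),
                    (fun k : ℕ ↦ (-1 : ℝ) ^ k * (q.descFactorial k : ℝ) * (a / π) ^ (k + 1)) x.1 * (fun k : ℕ ↦ -((a ^ (q - k) + (-a) ^ (q - k)) * (I ^ (k + 1)).re)) x.1 * (fun N : ℕ ↦ (if N % 4 = 1 then (1 : ℝ) else if N % 4 = 3 then -1 else 0)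
                            * (1 - 1 / (2 * (N : ℝ))
                                - (∑ l ∈ Finset.Icc 1 ν, (bernoulli (2 * l) : ℝ) / (2 * l) * 16 ^ l
                                    * (((N - 1).choose (2 * l - 1) : ℕ) : ℝ)) / 2)
                            * (a / (2 * π)) ^ N) x.2)
                - (∑ x ∈ (Finset.range (q + 1) ×ˢ Finset.range R).filter (fun x ↦ x.1 + 1 + (2 * x.2 + 1) = dd),
                    (fun k : ℕ ↦ (-1 : ℝ) ^ k * (q.descFactorial k : ℝ) * (a / π) ^ (k + 1)) x.1 * (fun k : ℕ ↦ -((a ^ (q - k) + (-a) ^ (q - k)) * (I ^ (k + 1)).re)) x.1 * (fun r : ℕ ↦ (-1 : ℝ) ^ r *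
                            (∑' l : ℕ, Real.exp (-(2 * a * digammaNode l)) * digammaNode l ^ (2 * r))
                            * (a / π) ^ (2 * r + 1)) x.2),
                fun dd : ℕ ↦ ∑ k ∈ (Finset.range (q + 1)).filter (fun k ↦ k + 1 = dd), (fun k : ℕ ↦ (-1 : ℝ) ^ k * (q.descFactorial k : ℝ) * (a / π) ^ (k + 1)) k * (fun k : ℕ ↦ (a ^ (q - k) - (-a) ^ (q - k)) * (I ^ (k + 1)).im) k / 2,
                fun dd : ℕ ↦ ∑ k ∈ (Finset.range (q + 1)).filter (fun k ↦ k + 1 = dd), (fun k : ℕ ↦ (-1 : ℝ) ^ k * (q.descFactorial k : ℝ) * (a / π) ^ (k + 1)) k * (fun k : ℕ ↦ (a ^ (q - k) - (-a) ^ (q - k)) * (I ^ (k + 1)).im) k,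
                fun dd : ℕ ↦ ∑ k ∈ (Finset.range (q + 1)).filter (fun k ↦ k + 1 = dd), (fun k : ℕ ↦ (-1 : ℝ) ^ k * (q.descFactorial k : ℝ) * (a / π) ^ (k + 1)) k * (fun k : ℕ ↦ -((a ^ (q - k) + (-a) ^ (q - k)) * (I ^ (k + 1)).re)) k] x.1) x.2)
              * (![(1 : ℝ), Real.log m, -(∑ n ∈ weilPrimeIndex a, (Λ n : ℝ) / Real.sqrt n * Real.cos (π * m / a * Real.log n)), (∑ n ∈ weilPrimeIndex a, (Λ n : ℝ) / Real.sqrt n * Real.sin (π * m / a * Real.log n))] x.1 / (m : ℝ) ^ (x.2 : ℕ))|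
      ≤ (1 / Real.sqrt (2 * a)) *
          ( |(8 * (∫ x in (-a)..a, x ^ q * Real.sinh (x / 2)) * (Real.exp (a / 2) - Real.exp (-(a / 2))))|
              * (a / (4 * π) * (a ^ 2 / (4 * π ^ 2)) ^ J / (m₀ : ℝ) ^ (2 * J + 1))
            + ∑ k ∈ Finset.range (q + 1), (q.descFactorial k : ℝ) * (a / (π * m₀)) ^ (k + 1) *
                ( |(a ^ (q - k) - (-a) ^ (q - k)) * (I ^ (k + 1)).im| *
                    ((4 * Real.pi ^ 2 / 3 * ((2 * ν + 1).factorial : ℝ) / (2 * Real.pi) ^ (2 * ν + 1)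
                      * (4 * (1 / (4 * (π * m₀ / a / 2)))) ^ (2 * ν)
                    + (1 / (4 * (π * m₀ / a / 2))) ^ (K + 1) / ((K + 1) * (1 - 1 / (4 * (π * m₀ / a / 2))))
                    + 2 * (1 / (4 * (π * m₀ / a / 2))) ^ (K + 1)
                    + ∑ k ∈ Finset.Icc 1 ν, |(bernoulli (2 * k) : ℝ) / (2 * k)| * 2 ^ (K + 1 + 4 * k)
                        * (1 / (4 * (π * m₀ / a / 2))) ^ (K + 1)) / 2
                  + (∑' k : ℕ, Real.exp (-(2 * a * digammaNode k)) * digammaNode k ^ (2 * R + 1))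
                      / |π * m₀ / a| ^ (2 * R + 2))
                  + |(a ^ (q - k) + (-a) ^ (q - k)) * (I ^ (k + 1)).re| *
                    ((4 * Real.pi ^ 2 / 3 * ((2 * ν + 1).factorial : ℝ) / (2 * Real.pi) ^ (2 * ν + 1)
                      * (4 * (1 / (4 * (π * m₀ / a / 2)))) ^ (2 * ν)
                    + (1 / (4 * (π * m₀ / a / 2))) ^ (K + 1) / ((K + 1) * (1 - 1 / (4 * (π * m₀ / a / 2))))
                    + 2 * (1 / (4 * (π * m₀ / a / 2))) ^ (K + 1)
                    + ∑ k ∈ Finset.Icc 1 ν, |(bernoulli (2 * k) : ℝ) / (2 * k)| * 2 ^ (K + 1 + 4 * k)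
                        * (1 / (4 * (π * m₀ / a / 2))) ^ (K + 1)) / 2
                  + (∑' k : ℕ, Real.exp (-(2 * a * digammaNode k)) * digammaNode k ^ (2 * R))
                      / |π * m₀ / a| ^ (2 * R + 1)) ) )
        * ((m₀ : ℝ) / m) ^ (E + 1) := by
  rw [← fourGroups_eq_sum_fin]
  exact abs_im_image_pow_sub_collected_le (ha := ha) (m₀ := m₀) (m := m) (hm₀ := hm₀) (hmm := hmm) (q := q) (ν := ν) (hν := hν) (K := K) (hK := hK) (R := R) (J := J) (E := E) (hE1 := hE1) (hE2 := hE2) (hE3 := hE3) (hEJ := hEJ) (D := D) (hDJ := hDJ) (hDK := hDK) (hDR := hDR)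

end Summit.RiemannHypothesis.RiemannHypothesis.Theorems.WeilFormatC
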